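import Literature.AlgebraicGeometry.Resolution.LogRegularEtaleCentre
import Literature.AlgebraicGeometry.Resolution.IdealSheafFlatDescent
import Literature.AlgebraicGeometry.Resolution.BlowupRegularFlatCover
import Literature.AlgebraicGeometry.Resolution.BlowupSequencesRestrictMarked
import Mathlib.AlgebraicGeometry.Morphisms.UniversallyOpen
import Mathlib.AlgebraicGeometry.Noetherian
import HarnessLib

/-!
# Resolution of a log regular scheme from affine étale pieces
# (ÉTALE KATO programme, block EK-7: assembly)

Topic: `Literature/AlgebraicGeometry/Resolution`. Kato 1994 (10.4) on étale charts / Nizioł 2006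
Cor. 5.7, weak form of the tree (`Scheme.HasResolution`): a locally Noetherian scheme `X` carrying
affine étale pieces with étale fs charts (`LogRegularAtlas.EtalePieces`, EK-3a) admits a resolution
of singularities, namely ONE blowing up along the descended centre:

1. EK-3b (`EtalePieces.exists_descent_centre`): ideal sheaves `J_k` on the pieces with
   `pr₁^* J_k = pr₂^* J_{k'}`, nowhere dense centres and regular blow-ups;
2. EK-5 (`comap_iInf_map_eq_of_descent`, effective fpqc descent of ideal sheaves): the ideal
   sheaf `J := ⨅_k (e_k)_♯ J_k` of `X` satisfies `e_k^* J = J_k` (the `e_k` are flat, quasi-compact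
   and open — flat and locally of finite presentation);
3. EK-6 (`IsBlowup.isResolution_of_flat_cover`): `Bl_J X → X` is proper birational with regular
   source, since so after the flat jointly surjective base changes `e_k` (blow-ups commute with
   flat base change).

References: [Kato1994] (10.3)–(10.4); [Niziol2006] Cor. 5.7; [GortzWedhorn2020] Prop. 13.91;
[StacksProject] Tag 0245.
-/

noncomputable section

open AlgebraicGeometry CategoryTheory CategoryTheory.Limits TopologicalSpace Opposite

namespace Literature.AlgebraicGeometry.Resolution

universe u

namespace LogRegularAtlas.EtalePieces

variable {X : Scheme.{u}} {M : Model}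

/-- The structure morphisms of the pieces are open maps (flat and locally of finite presentation —
of finite type over the locally Noetherian `X` — hence universally open).
[cite: StacksProject, Tag 01UA] -/
theorem isOpenMap_e [IsLocallyNoetherian X] (E : EtalePieces X M) (k : E.κ) :
    IsOpenMap (E.e k).base :=
  (E.e k).isOpenMap

/-- **Resolution of singularities of a log regular scheme with étale charts, from its affine
étale pieces** (Kato 1994 (10.4) on étale charts; Nizioł 2006 Cor. 5.7, weak form): the blowing
up of `X` along the descended centre `J = ⨅_k (e_k)_♯ J_k` is a resolution — `e_k^* J = J_k`
by effective descent, and properness, birationality and regularity are detected after the flat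
covering base changes `e_k`. [cite: Kato1994, (10.4)] [cite: Niziol2006, Cor. 5.7] -/
theorem hasResolution [IsLocallyNoetherian X] (E : EtalePieces X M) : Scheme.HasResolution X := by
  obtain ⟨J, hdesc, hdense, hreg⟩ := E.exists_descent_centre
  have hK : ∀ k, (⨅ k', (J k').map (E.e k')).comap (E.e k) = J k :=
    fun k => comap_iInf_map_eq_of_descent E.e J hdesc E.isOpenMap_e k
  haveI := CentreSeq.isLocallyNoetherian_blowup (⨅ k', (J k').map (E.e k'))
  refine ⟨_, blowup.π _, (blowup.isBlowup (⨅ k', (J k').map (E.e k'))).isResolution_of_flat_cover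
    E.e E.surj (fun U => (IsLocallyNoetherian.component_noetherian U).noetherian _) (fun k => ?_)
    (fun k P q hq => ?_)⟩
  · rw [hK]
    exact hdense k
  · rw [hK] at hq
    exact hreg k q hq

end LogRegularAtlas.EtalePieces

end Literature.AlgebraicGeometry.Resolution

end
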